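import Summits.HodgeConjecture.CorCM.PairFlipTransportPairwise
import Summits.HodgeConjecture.CorCM.PairFlipCMFieldOffClosureHodge
import Summits.HodgeConjecture.CorCM.PairFlipSameClosurePairwise
import Literature.NumberTheory.ComplexMultiplication.HilbertModularCMPoints
import HarnessLib

/-!
# A CM field with pair flips against ANY non-isomorphic CM field of the same degree whose conjugate pairs the flips
# preserve: `Hg(A₀ × A₁) = Hg(A₀) × Hg(A₁)` iff the partner is nondegenerate

COR-CM (cell `pub-hodgecm2`, binder seat `b16` gen 51, count-neutral claim PAIRFLIP-COMPANION, file F2 — CM fields and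
abelian varieties; theorems only, no definition, no named fact, no `sorry`).  NEW as stated, hence under `Summits/`.
HONEST FRAMING: unconditional theorems on pairs of CM abelian varieties; `HC_CM` is neither used nor asserted.

SETTING.  `K_{i₀}` is a CM field with PAIR FLIPS COMPATIBLE WITH `K_{i₁}`: for every embedding `s` of `K_{i₀}` some
`σ ∈ Aut(ℂ)` has `σ ∘ s = s̄`, fixes every other embedding of `K_{i₀}`, AND maps every embedding `y` of `K_{i₁}` to `y`
or `ȳ`.  The first two clauses say that the Galois closure of `K_{i₀}` contains the full sign group `(ℤ/2)ⁿ` (the generic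
CM fields of every degree; every sextic CM field with closure of degree `24`/`48`); the third holds as soon as every
automorphism of `ℂ` fixing the images of the maximal real subfield `K_{i₀}⁺` fixes the images of `K_{i₁}⁺`
(`pairFlip_compatible_of_fix`) — e.g. when `K_{i₀}⁺` and `K_{i₁}⁺` receive a common totally real field of half the
degree (`pairFlip_compatible_of_ringHom_real`: the CM quadratic extensions `F(√−α)`, `F(√−β)`, … of ONE totally real
`F`).  NO condition on the Galois closure of `K_{i₁}` and no pair flips for `K_{i₁}` are asked.

* §1 `nonempty_ringEquiv_of_equivariant` — an `Aut(ℂ)`-equivariant bijection `Hom(K_i, ℂ) ≃ Hom(K_j, ℂ)` gives `K_i ≅ K_j`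
  (equal stabilisers, Galois correspondence for `Aut(ℂ)`: `fieldRange_le_of_stabilizer_le`).
* §2 **`pairwise_of_pairFlip_compatible`** — `[K_{i₀}:ℚ] = [K_{i₁}:ℚ]`, `K_{i₀} ≇ K_{i₁}` ⟹ the slots have NO COMMON
  CONSTITUENT in either order (F1b `PairFlipTransport.pairwise_of_forall_not_equivariant`); hence for the two-slot family
  **`isNondegenerateFamily_iff_of_pairFlip_compatible`**: `(Φ_{i₀}, Φ_{i₁})` is nondegenerate ⟺ `Φ_{i₁}` is
  (`Φ_{i₀}` is automatically), and `cmFamilyRank_add_card_eq_of_pairFlip_compatible` (`Hg(A₀ × A₁) = Hg(A₀) × Hg(A₁)`).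
* §3 on abelian varieties: **`hodgeConjectureFor_prod_of_pairFlip_compatible`** — the Hodge conjecture with `B• = D•` on
  every `A₀^a × A₁^b` for realisations, `Φ_{i₁}` nondegenerate, UNCONDITIONALLY;
  **`forall_prod_hodgeClassSpan_eq_iff_of_pairFlip_compatible`** — simple non-isogenous realisations: `B• = D•` on all
  products ⟺ `Φ_{i₁}` nondegenerate (else an exceptional Hodge class on some product — indeed on a power of `A₁` alone).
* §4 the compatibility clause from the real subfields (`pairFlip_compatible_of_fix`, `pairFlip_compatible_of_ringHom_real`).

The sextic twin theorem `PairFlipSameClosurePairwise` (b16 gen 43: `F(√−α)` vs `F(√(−α·disc F))`, both pair-flip, one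
closure of degree `48`) is the degree-`6` case; here the degree, the closure of `K_{i₁}` and its sign group are arbitrary.

## References

* [Dodson1984] B. Dodson, *The structure of Galois groups of CM-fields*, Trans. AMS 283 (1984), §1.1, §5.1.2.
* [Gordon1999HodgeAVSurvey] B. B. Gordon, *A survey of the Hodge conjecture for abelian varieties*, §3 Theorem, 7.4–7.7,
  10.10.
* [Lang2002] S. Lang, *Algebra*, GTM 211, V §2 Thm. 2.8, VI §1 Thm. 1.1 and Cor. 1.6.
* [Shimura1998] G. Shimura, *Abelian Varieties with Complex Multiplication and Modular Functions*, §5.2 Thm. 1, §18.2.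
-/

noncomputable section

open CategoryTheory CategoryTheory.Limits NumberField Module IntermediateField

namespace Summit.HodgeConjecture.CorCM

open Literature.NumberTheory.ComplexMultiplication
open Literature.AlgebraicGeometry.Motives (AbelianVariety CMType)
open Literature.AlgebraicGeometry.HodgeTheory
open Literature.AlgebraicGeometry.ComplexMultiplication (IsCMTypeRealisation isSimple_iff_isPrimitive)
open Literature.AlgebraicGeometry.VanGeemen1994 (hodgeClassSpan)
open Literature.AlgebraicGeometry.Pohlmann1968
open Literature.Barriers.HodgeConjecture (divisorClassesSpan)

variable {I : Type} {K : I → Type} [∀ i, Field (K i)] [∀ i, NumberField (K i)] [∀ i, IsCMField (K i)] [Fintype I]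
  [DecidableEq I] {Φ : ∀ i, CMType (K i)}

/-! ## §1 An equivariant bijection of embedding sets is a field isomorphism -/

section Relabel

omit [∀ i, IsCMField (K i)] [Fintype I] [DecidableEq I] in
/-- **An `Aut(ℂ)`-equivariant bijection `Hom(K_i, ℂ) ≃ Hom(K_j, ℂ)` forces `K_i ≅ K_j`**: `x` and `γ(x)` have the same
stabiliser in `Aut(ℂ)`, hence the same image (Galois correspondence for `Aut(ℂ)` over number subfields).
[cite: Lang2002, VI §1 Thm. 1.1 and Cor. 1.6] -/
theorem nonempty_ringEquiv_of_equivariant {i j : I} (γ : (K i →+* ℂ) ≃ (K j →+* ℂ))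
    (hγ : ∀ (g : ℂ ≃+* ℂ) (x : K i →+* ℂ), γ (g • x) = g • γ x) : Nonempty (K i ≃+* K j) := by
  obtain ⟨x⟩ : Nonempty (K i →+* ℂ) := inferInstance
  have h1 : x.toRatAlgHom.fieldRange ≤ (γ x).toRatAlgHom.fieldRange :=
    fieldRange_le_of_stabilizer_le fun τ hτ => γ.injective (by rw [hγ, hτ])
  have h2 : (γ x).toRatAlgHom.fieldRange ≤ x.toRatAlgHom.fieldRange :=
    fieldRange_le_of_stabilizer_le fun τ hτ => by rw [← hγ, hτ]
  exact ⟨((AlgEquiv.ofInjectiveField x.toRatAlgHom).trans ((IntermediateField.equivOfEq (le_antisymm h1 h2)).trans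
    (AlgEquiv.ofInjectiveField (γ x).toRatAlgHom).symm)).toRingEquiv⟩

end Relabel

/-! ## §2 The pairwise criterion and the two-slot family -/

section Types

omit [Fintype I] [DecidableEq I] in
/-- **No common constituent, both orders.**  `K_{i₀}` with pair flips compatible with `K_{i₁}`, equal degrees,
`K_{i₀} ≇ K_{i₁}`: every `Aut(ℂ)`-stable `P ≤ U(Φ_{i₀})` with an equivariant injection into `U(Φ_{i₁})` is zero, and the
same with the slots exchanged (an equivariant injection would relabel `Hom(K_{i₀}, ℂ) ≃ Hom(K_{i₁}, ℂ)`, F1/F1b, forcing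
`K_{i₀} ≅ K_{i₁}`, §1). [cite: Dodson1984, §5.1.2] [cite: Gordon1999HodgeAVSurvey, §3 Theorem (proof) and 7.5–7.7] -/
theorem pairwise_of_pairFlip_compatible {i₀ i₁ : I}
    (hflip : ∀ s : K i₀ →+* ℂ, ∃ σ : ℂ ≃+* ℂ, σ • s = (starRingAut : ℂ ≃+* ℂ) • s ∧
      (∀ t : K i₀ →+* ℂ, t ≠ s → t ≠ (starRingAut : ℂ ≃+* ℂ) • s → σ • t = t) ∧
      ∀ y : K i₁ →+* ℂ, σ • y = y ∨ σ • y = (starRingAut : ℂ ≃+* ℂ) • y)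
    (hdeg : finrank ℚ (K i₀) = finrank ℚ (K i₁)) (hne : IsEmpty (K i₀ ≃+* K i₁)) :
    (∀ P : Submodule ℚ ((K i₀ →+* ℂ) → ℚ), P ≤ antiSpan (ℂ ≃+* ℂ) (Φ i₀).1 →
      (∀ g : ℂ ≃+* ℂ, ∀ f ∈ P, (fun x => f (g • x)) ∈ P) →
      ∀ T : ((K i₀ →+* ℂ) → ℚ) →ₗ[ℚ] ((K i₁ →+* ℂ) → ℚ),
        (∀ g : ℂ ≃+* ℂ, ∀ f ∈ P, T (fun x => f (g • x)) = fun y => T f (g • y)) →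
        (∀ f ∈ P, T f ∈ antiSpan (ℂ ≃+* ℂ) (Φ i₁).1) → (∀ f ∈ P, T f = 0 → f = 0) → P = ⊥) ∧
    (∀ P : Submodule ℚ ((K i₁ →+* ℂ) → ℚ), P ≤ antiSpan (ℂ ≃+* ℂ) (Φ i₁).1 →
      (∀ g : ℂ ≃+* ℂ, ∀ f ∈ P, (fun y => f (g • y)) ∈ P) →
      ∀ T' : ((K i₁ →+* ℂ) → ℚ) →ₗ[ℚ] ((K i₀ →+* ℂ) → ℚ),
        (∀ g : ℂ ≃+* ℂ, ∀ f ∈ P, T' (fun y => f (g • y)) = fun x => T' f (g • x)) →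
        (∀ f ∈ P, T' f ∈ antiSpan (ℂ ≃+* ℂ) (Φ i₀).1) → (∀ f ∈ P, T' f = 0 → f = 0) → P = ⊥) := by
  classical
  haveI := isPretransitive_ringEquiv_complex (K := K i₀)
  have hcard : Fintype.card (K i₀ →+* ℂ) = Fintype.card (K i₁ →+* ℂ) := by
    rw [Embeddings.card, Embeddings.card, hdeg]
  have hne' : ∀ γ : (K i₀ →+* ℂ) ≃ (K i₁ →+* ℂ), ¬ ∀ (g : ℂ ≃+* ℂ) (x : K i₀ →+* ℂ), γ (g • x) = g • γ x :=
    fun γ hγ => hne.false (nonempty_ringEquiv_of_equivariant γ hγ).some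
  exact PairFlipTransport.pairwise_of_forall_not_equivariant (isCMTypeWith_conj (Φ i₀)) (isCMTypeWith_conj (Φ i₁))
    hflip hcard hne'

variable [Nonempty I]

/-- **The two-slot family is nondegenerate iff the partner type is.**  `K_{i₀}` with pair flips compatible with `K_{i₁}`,
`[K_{i₀}:ℚ] = [K_{i₁}:ℚ]`, `K_{i₀} ≇ K_{i₁}`, `I = {i₀, i₁}`: `(Φ_{i₀}, Φ_{i₁})` is nondegenerate — `Hg(A₀ × A₁) = Hg(A₀) ×
Hg(A₁)` with both factors of full rank — iff `Φ_{i₁}` is nondegenerate (`Φ_{i₀}` is, by the pair flips).  No hypothesis on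
the Galois closure or the sign group of `K_{i₁}`. [cite: Gordon1999HodgeAVSurvey, §3 Theorem and 7.5–7.7]
[cite: Dodson1984, §1.1 and §5.1.2] -/
theorem isNondegenerateFamily_iff_of_pairFlip_compatible {i₀ i₁ : I} (hI : ∀ j, j = i₀ ∨ j = i₁)
    (hflip : ∀ s : K i₀ →+* ℂ, ∃ σ : ℂ ≃+* ℂ, σ • s = (starRingAut : ℂ ≃+* ℂ) • s ∧
      (∀ t : K i₀ →+* ℂ, t ≠ s → t ≠ (starRingAut : ℂ ≃+* ℂ) • s → σ • t = t) ∧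
      ∀ y : K i₁ →+* ℂ, σ • y = y ∨ σ • y = (starRingAut : ℂ ≃+* ℂ) • y)
    (hdeg : finrank ℚ (K i₀) = finrank ℚ (K i₁)) (hne : IsEmpty (K i₀ ≃+* K i₁)) :
    CMAlgebra.IsNondegenerateFamily Φ ↔ IsNondegenerate (Φ i₁) := by
  have h01 : i₀ ≠ i₁ := fun h => by subst h; exact hne.false (RingEquiv.refl _)
  obtain ⟨-, -, hnd₀⟩ := irreducible_and_finrank_eq_of_pairFlip (Φ := Φ)
    (fun s => (hflip s).imp fun σ h => ⟨h.1, h.2.1⟩)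
  have hp := pairwise_of_pairFlip_compatible (Φ := Φ) hflip hdeg hne
  rw [isNondegenerateFamily_iff_forall_of_pairwise Φ fun i j hij => ?_]
  · exact ⟨fun h => h i₁, fun h i => by rcases hI i with rfl | rfl <;> assumption⟩
  · rcases hI i with rfl | rfl <;> rcases hI j with rfl | rfl
    · exact absurd rfl hij
    · exact hp.1
    · exact hp.2
    · exact absurd rfl hij

/-- **Rank additivity**: `rank(Φ_{i₀}, Φ_{i₁}) + 2 = rank Φ_{i₀} + rank Φ_{i₁} + 1`, i.e. `Hg(A₀ × A₁) = Hg(A₀) × Hg(A₁)`,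
for a pair-flip field against a compatible non-isomorphic partner of the same degree, whatever the types.
[cite: Gordon1999HodgeAVSurvey, §3 Theorem (1)] -/
theorem cmFamilyRank_add_card_eq_of_pairFlip_compatible {i₀ i₁ : I} (hI : ∀ j, j = i₀ ∨ j = i₁)
    (hflip : ∀ s : K i₀ →+* ℂ, ∃ σ : ℂ ≃+* ℂ, σ • s = (starRingAut : ℂ ≃+* ℂ) • s ∧
      (∀ t : K i₀ →+* ℂ, t ≠ s → t ≠ (starRingAut : ℂ ≃+* ℂ) • s → σ • t = t) ∧
      ∀ y : K i₁ →+* ℂ, σ • y = y ∨ σ • y = (starRingAut : ℂ ≃+* ℂ) • y)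
    (hdeg : finrank ℚ (K i₀) = finrank ℚ (K i₁)) (hne : IsEmpty (K i₀ ≃+* K i₁)) :
    CMAlgebra.cmFamilyRank Φ + Fintype.card I = (∑ i, cmTypeRank (Φ i)) + 1 := by
  have hp := pairwise_of_pairFlip_compatible (Φ := Φ) hflip hdeg hne
  refine cmFamilyRank_add_card_eq_of_pairwise Φ fun i j hij => ?_
  rcases hI i with rfl | rfl <;> rcases hI j with rfl | rfl
  · exact absurd rfl hij
  · exact hp.1
  · exact hp.2
  · exact absurd rfl hij

end Types

/-! ## §3 Abelian varieties -/

section Geometry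

variable [Nonempty I] {A : I → AbelianVariety ℂ} {ι : ∀ i, 𝓞 (K i) →+* End (A i)}
  {θ : ∀ i, K i →+* Module.End ℂ (complexBetti (A i).X 1)}

/-- **The Hodge conjecture on every `A₀^a × A₁^b`** (every `⨁_{j<N} A_{π j}`), with `B• = D•` there, for realisations of
ANY type of a CM field `K_{i₀}` with pair flips compatible with `K_{i₁}` and of a NONDEGENERATE type of a non-isomorphic
`K_{i₁}` of the same degree — UNCONDITIONALLY. [cite: Gordon1999HodgeAVSurvey, §3 Theorem, 7.5 and 10.10] -/
theorem hodgeConjectureFor_prod_of_pairFlip_compatible {i₀ i₁ : I} (hI : ∀ j, j = i₀ ∨ j = i₁)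
    (hflip : ∀ s : K i₀ →+* ℂ, ∃ σ : ℂ ≃+* ℂ, σ • s = (starRingAut : ℂ ≃+* ℂ) • s ∧
      (∀ t : K i₀ →+* ℂ, t ≠ s → t ≠ (starRingAut : ℂ ≃+* ℂ) • s → σ • t = t) ∧
      ∀ y : K i₁ →+* ℂ, σ • y = y ∨ σ • y = (starRingAut : ℂ ≃+* ℂ) • y)
    (hdeg : finrank ℚ (K i₀) = finrank ℚ (K i₁)) (hne : IsEmpty (K i₀ ≃+* K i₁)) (hnd : IsNondegenerate (Φ i₁))
    (hA : ∀ i, IsCMTypeRealisation (Φ i) (A i) (ι i) (θ i)) {N : ℕ} (π : Fin N → I) :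
    HodgeConjectureFor (⨁ fun j : Fin N => A (π j)).dim (⨁ fun j : Fin N => A (π j)).X ∧
      ∀ m : ℕ, hodgeClassSpan (⨁ fun j : Fin N => A (π j)).dim (⨁ fun j : Fin N => A (π j)).X m =
        divisorClassesSpan (⨁ fun j : Fin N => A (π j)).X (⨁ fun j : Fin N => A (π j)).dim m :=
  have h := (isNondegenerateFamily_iff_of_pairFlip_compatible hI hflip hdeg hne).2 hnd
  ⟨h.hodgeConjectureFor_prod hA π, fun m => h.hodgeClassSpan_prod_eq_divisorClassesSpan hA π m⟩

/-- **`B• = D•` on ALL `A₀^a × A₁^b` iff the partner type is nondegenerate**, for SIMPLE, non-isogenous realisations;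
otherwise some product carries an exceptional Hodge class (Hazama–Murty) — and then already some power of `A₁` alone
does (`Φ_{i₁}` degenerate). [cite: Gordon1999HodgeAVSurvey, 7.5 (1) ⟺ (3) and 7.6.1] -/
theorem forall_prod_hodgeClassSpan_eq_iff_of_pairFlip_compatible {i₀ i₁ : I} (hI : ∀ j, j = i₀ ∨ j = i₁)
    (hflip : ∀ s : K i₀ →+* ℂ, ∃ σ : ℂ ≃+* ℂ, σ • s = (starRingAut : ℂ ≃+* ℂ) • s ∧
      (∀ t : K i₀ →+* ℂ, t ≠ s → t ≠ (starRingAut : ℂ ≃+* ℂ) • s → σ • t = t) ∧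
      ∀ y : K i₁ →+* ℂ, σ • y = y ∨ σ • y = (starRingAut : ℂ ≃+* ℂ) • y)
    (hdeg : finrank ℚ (K i₀) = finrank ℚ (K i₁)) (hne : IsEmpty (K i₀ ≃+* K i₁))
    (hA : ∀ i, IsCMTypeRealisation (Φ i) (A i) (ι i) (θ i)) (hS : ∀ i, (A i).IsSimple)
    (hniso : ∀ i j, i ≠ j → ¬ AbelianVariety.IsIsogenous (A i) (A j)) :
    (∀ (N : ℕ) (π : Fin N → I) (m : ℕ),
      hodgeClassSpan (⨁ fun j : Fin N => A (π j)).dim (⨁ fun j : Fin N => A (π j)).X m =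
        divisorClassesSpan (⨁ fun j : Fin N => A (π j)).X (⨁ fun j : Fin N => A (π j)).dim m) ↔
      IsNondegenerate (Φ i₁) := by
  constructor
  · intro h
    by_contra hdegn
    have hfam : ¬ CMAlgebra.IsNondegenerateFamily Φ := fun hf =>
      hdegn ((isNondegenerateFamily_iff_of_pairFlip_compatible hI hflip hdeg hne).1 hf)
    obtain ⟨N, π, m, c, hcQ, hcH, hcD⟩ := CMAlgebra.exists_exceptional_prod_of_not_isNondegenerateFamily
      (CMAlgebra.isSeparatingFamily_of_isSimple_of_pairwise_not_isIsogenous hA hS hniso) hfam hA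
    exact hcD (by rw [← h N π m]; exact Submodule.subset_span ⟨hcQ, hcH⟩)
  · intro hnd N π m
    exact (hodgeConjectureFor_prod_of_pairFlip_compatible hI hflip hdeg hne hnd hA π).2 m

end Geometry

/-! ## §4 The compatibility clause from the maximal real subfields -/

section Compatible

omit [Fintype I] [DecidableEq I] in
/-- **A pair flip of `K_{i₀}` fixes the images of the maximal real subfield `K_{i₀}⁺` under EVERY embedding**: it fixes
the embeddings off the flipped pair entirely, and on the flipped pair it acts as complex conjugation, trivial on `K_{i₀}⁺`.
[cite: Shimura1998, §18.2 Lemma (i)] [cite: Dodson1984, §1.1] -/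
theorem apply_eq_of_pairFlip_of_mem_maximalRealSubfield {i₀ : I} (Ψ : CMType (K i₀)) {s : K i₀ →+* ℂ} {σ : ℂ ≃+* ℂ}
    (hσs : σ • s = (starRingAut : ℂ ≃+* ℂ) • s)
    (hσ : ∀ t : K i₀ →+* ℂ, t ≠ s → t ≠ (starRingAut : ℂ ≃+* ℂ) • s → σ • t = t)
    (x : K i₀ →+* ℂ) {r : K i₀} (hr : r ∈ maximalRealSubfield (K i₀)) : σ (x r) = x r := by
  have hreal : ∀ φ : K i₀ →+* ℂ, starRingEnd ℂ (φ r) = φ r := fun φ => by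
    rw [starRingEnd_apply]; exact (mem_maximalRealSubfield_iff r).1 hr φ
  have hCM := isCMTypeWith_conj Ψ
  by_cases h1 : x = s
  · subst h1
    have := RingHom.congr_fun hσs r
    rw [ringEquiv_smul_apply, conj_smul_eq_conjugate, ComplexEmbedding.conjugate_coe_eq, hreal] at this
    exact this
  · by_cases h2 : x = (starRingAut : ℂ ≃+* ℂ) • s
    · subst h2
      have h3 : σ • (starRingAut : ℂ ≃+* ℂ) • s = s := by rw [hCM.comm σ s, hσs, hCM.invol]
      have := RingHom.congr_fun h3 r
      rw [ringEquiv_smul_apply] at this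
      rw [this, conj_smul_eq_conjugate, ComplexEmbedding.conjugate_coe_eq, hreal]
    · have := RingHom.congr_fun (hσ x h1 h2) r
      rwa [ringEquiv_smul_apply] at this

omit [Fintype I] [DecidableEq I] in
/-- **Compatibility from the real subfields.**  Let `K_{i₀}` have pair flips, let `F` be a totally real field with
`e₁ : F → K_{i₁}`, `[K_{i₁} : ℚ] = 2[F : ℚ]`, and suppose every automorphism of `ℂ` fixing the images of `K_{i₀}⁺` under all
embeddings fixes the images of `e₁(F)` under all embeddings of `K_{i₁}` (`e₁(F)` inside the Galois closure of `K_{i₀}⁺`).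
Then the pair flips of `K_{i₀}` are compatible with `K_{i₁}`: they map each embedding `y` of `K_{i₁}` to `y` or `ȳ` (the two
extensions of `y|_{e₁(F)}` to the totally imaginary quadratic extension `K_{i₁}`).
[cite: Shimura1998, §5.2 Thm. 1 (CM2) and §18.2] [cite: Lang2002, V §2 Thm. 2.8] -/
theorem pairFlip_compatible_of_fix {i₀ i₁ : I} (Ψ : CMType (K i₀))
    (hflip : ∀ s : K i₀ →+* ℂ, ∃ σ : ℂ ≃+* ℂ, σ • s = (starRingAut : ℂ ≃+* ℂ) • s ∧
      ∀ t : K i₀ →+* ℂ, t ≠ s → t ≠ (starRingAut : ℂ ≃+* ℂ) • s → σ • t = t)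
    {F : Type} [Field F] [NumberField F] [IsTotallyReal F] (e₁ : F →+* K i₁)
    (hF : finrank ℚ (K i₁) = 2 * finrank ℚ F)
    (hfix : ∀ σ : ℂ ≃+* ℂ, (∀ (x : K i₀ →+* ℂ) (r : K i₀), r ∈ maximalRealSubfield (K i₀) → σ (x r) = x r) →
      ∀ (y : K i₁ →+* ℂ) (f : F), σ (y (e₁ f)) = y (e₁ f)) :
    ∀ s : K i₀ →+* ℂ, ∃ σ : ℂ ≃+* ℂ, σ • s = (starRingAut : ℂ ≃+* ℂ) • s ∧
      (∀ t : K i₀ →+* ℂ, t ≠ s → t ≠ (starRingAut : ℂ ≃+* ℂ) • s → σ • t = t) ∧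
      ∀ y : K i₁ →+* ℂ, σ • y = y ∨ σ • y = (starRingAut : ℂ ≃+* ℂ) • y := by
  -- `K_{i₁}` as a quadratic extension of the totally real `F`
  letI : Algebra F (K i₁) := e₁.toAlgebra
  haveI : IsScalarTower ℚ F (K i₁) := IsScalarTower.of_algebraMap_eq fun q => (map_ratCast e₁ q).symm
  haveI : FiniteDimensional F (K i₁) := Module.Finite.of_restrictScalars_finite ℚ F (K i₁)
  have hfin : finrank F (K i₁) = 2 := by
    have h := Module.finrank_mul_finrank ℚ F (K i₁)
    rw [hF, mul_comm 2] at h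
    exact Nat.eq_of_mul_eq_mul_left finrank_pos h
  haveI : Algebra.IsQuadraticExtension F (K i₁) := ⟨hfin⟩
  intro s
  obtain ⟨σ, hσs, hσ⟩ := hflip s
  refine ⟨σ, hσs, hσ, fun y => ?_⟩
  have hfixσ := hfix σ (fun x r hr => apply_eq_of_pairFlip_of_mem_maximalRealSubfield Ψ hσs hσ x hr) y
  have hcomp : (σ • y).comp (algebraMap F (K i₁)) = y.comp (algebraMap F (K i₁)) :=
    RingHom.ext fun f => by
      rw [RingHom.comp_apply, RingHom.comp_apply, ringEquiv_smul_apply]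
      exact hfixσ f
  rcases HilbertCMPoint.eq_or_eq_conjugate_of_comp_eq F (K i₁) hcomp with h | h
  · exact Or.inl h
  · exact Or.inr (by rw [h, conj_smul_eq_conjugate])

omit [Fintype I] [DecidableEq I] in
/-- **A common totally real subfield of half the degree makes the pair flips compatible.**  `K_{i₀}` with pair flips,
`F` totally real with `e₀ : F → K_{i₀}`, `e₁ : F → K_{i₁}` and `[K_{i₁} : ℚ] = 2[F : ℚ]` (so `e₁(F) = K_{i₁}⁺`; e.g. `K_{i₀} =
F(√−α)`, `K_{i₁} = F(√−β)`): every image `y(e₁ f)` is some `x(e₀ f)` with `e₀ f ∈ K_{i₀}⁺`, so the flips of `K_{i₀}` preserve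
the conjugate pairs of `K_{i₁}`. [cite: Shimura1998, §5.2 Thm. 1 and §18.2] [cite: Dodson1984, §1.1] -/
theorem pairFlip_compatible_of_ringHom_real {i₀ i₁ : I} (Ψ : CMType (K i₀))
    (hflip : ∀ s : K i₀ →+* ℂ, ∃ σ : ℂ ≃+* ℂ, σ • s = (starRingAut : ℂ ≃+* ℂ) • s ∧
      ∀ t : K i₀ →+* ℂ, t ≠ s → t ≠ (starRingAut : ℂ ≃+* ℂ) • s → σ • t = t)
    {F : Type} [Field F] [NumberField F] [IsTotallyReal F] (e₀ : F →+* K i₀) (e₁ : F →+* K i₁)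
    (hF : finrank ℚ (K i₁) = 2 * finrank ℚ F) :
    ∀ s : K i₀ →+* ℂ, ∃ σ : ℂ ≃+* ℂ, σ • s = (starRingAut : ℂ ≃+* ℂ) • s ∧
      (∀ t : K i₀ →+* ℂ, t ≠ s → t ≠ (starRingAut : ℂ ≃+* ℂ) • s → σ • t = t) ∧
      ∀ y : K i₁ →+* ℂ, σ • y = y ∨ σ • y = (starRingAut : ℂ ≃+* ℂ) • y := by
  refine pairFlip_compatible_of_fix Ψ hflip e₁ hF fun σ hσ y f => ?_
  -- `y ∘ e₁ : F → ℂ` extends along `e₀` to an embedding `x` of `K_{i₀}`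
  letI : Algebra F (K i₀) := e₀.toAlgebra
  haveI : IsScalarTower ℚ F (K i₀) := IsScalarTower.of_algebraMap_eq fun q => (map_ratCast e₀ q).symm
  haveI : Module.Finite F (K i₀) := Module.Finite.of_restrictScalars_finite ℚ F (K i₀)
  haveI : Algebra.IsAlgebraic F (K i₀) := Algebra.IsAlgebraic.of_finite F (K i₀)
  set x : K i₀ →+* ℂ := NumberField.ComplexEmbedding.lift (K i₀) (y.comp e₁) with hx_def
  have h1 : y (e₁ f) = x (e₀ f) := by
    have := NumberField.ComplexEmbedding.lift_algebraMap_apply (K i₀) (y.comp e₁) f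
    rw [RingHom.comp_apply] at this
    exact this.symm
  -- `e₀ f` is real under every embedding (F is totally real)
  have h2 : e₀ f ∈ maximalRealSubfield (K i₀) := by
    rw [mem_maximalRealSubfield_iff]
    intro φ
    have hr : ComplexEmbedding.IsReal (φ.comp e₀) :=
      InfinitePlace.isReal_mk_iff.mp (IsTotallyReal.isReal _)
    have := RingHom.congr_fun (ComplexEmbedding.isReal_iff.mp hr) f
    rw [ComplexEmbedding.conjugate_coe_eq, RingHom.comp_apply, starRingEnd_apply] at this
    exact this
  rw [h1]
  exact hσ x (e₀ f) h2

end Compatible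

end Summit.HodgeConjecture.CorCM

end
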